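import Literature.Analysis.FunctionSpaces.TorusTrigPolyDifferences
import Literature.Analysis.FunctionSpaces.TorusKernelMomentCS
import Literature.Analysis.FunctionSpaces.TorusTransportFluxKernel
import Literature.Analysis.Fourier.LatticeDifferenceBounds
import Literature.Analysis.Fourier.LineRestrictionDerivBound
import HarnessLib

/-!
# The third moment of the dissipation-scale flux kernel: `∫_𝕋 |z|³ Σ_a |∂_a K_ω(z)| dz ≤ C ε²`

Analysis/Fourier support file (pure proof layer, no definitions, no named facts).  The last analytic input (P2d)
of the two-weight Lyapunov bound for advection–diffusion on `𝕋^d`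
(`FluidPDE.PassiveVectorTensorWeightedDecay.ae_twoWeight_decay`, hypothesis `hM`): for a smooth profile `Ψ`
vanishing on `[1, ∞)` and the weight `ω_k = Ψ(ε²|k|²)` carried by the frequency ball `F = freqBall ⌈1/ε⌉`, the
gradient flux kernel `∂_a K_ω(z) = Σ_{k∈F} ω_k (2πi k_a e_k(z)).re` (`Torus.fluxKernelGrad`) has third moment
  `M₃(ε) = ∫_𝕋 ‖reprc z‖³ Σ_a |∂_a K_ω(z)| dz ≤ C(d, Ψ) · ε²`    (`0 < ε ≤ 1`),
the scaling of `ε^{-d-1} (∇Ψ̂)(z/ε)`.  With `ε² = 8π² lo τ` this makes the flux condition `Lip(b)·M₃ ≤ (4/5)·lo` of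
the two-weight theorem hold for `τ ≤ c/(Lip(b))` — a window inversely proportional to the strain rate.

Route (elementary, no Poisson summation): Cauchy–Schwarz with the weight `(ε² + |z|²)^s`, `2s > d + 6`
(`integral_cube_moment_le_sqrt_mul_sqrt`); the weight integral is `≤ ε^{6+d-2s}·I_d` (`integral_norm_reprc_six_div_weight_le`);
the binomial expansion of `∫ (ε²+|z|²)^s |K_a|²` (`integral_weight_mul_norm_sq_eq_sum`) has terms
`∫ |z|^{2i} |K_a|² ≤ (d^{i-1}/16^i) Σ_j Σ_{k∈B} |D_j^i c_a(k)|²` (`integral_norm_reprc_pow_mul_norm_sq_trigPoly_le`, Jordan +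
summation by parts) and `D_j^i c_a(k) = O(ε^{i-1})` because `c_a(k) = ε⁻¹ H_a(εk)` samples the smooth compactly supported
symbol `H_a(η) = Ψ(|η|²)·2πiη_a` (`LatticeDiff.norm_iterate_latticeDiff_le`, `norm_iteratedDeriv_scaledSymbol_line_le`);
the box `B` has `≤ ((2s+5)/ε)^d` points.  Product: `ε^{6+d-2s} · ε^{2s-d-2} = ε⁴` under the square root.
* §1 `norm_iterate_latticeDiff_scaledSymbol_le` — `‖D_j^p c(k)‖ ≤ ε^{p-1} sup‖D^p H‖` for `c(k) = ε⁻¹H(εk)`;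
* §2 (file-local) `card_piFinset_Icc`, `freqBall_subset_piFinset_Icc`, `add_single_mem_piFinset_Icc_of_mem_freqBall` — the box;
* §3 `dissipWeight_eq_zero_of_not_mem_freqBall` — `ω_k = 0` off `freqBall ⌈1/ε⌉`;
  `abs_fluxKernelGrad_le_norm_trigPoly` — `|∂_a K_ω(z)| ≤ ‖Σ_k e_k(z) c_a(k)‖`;
  `exists_cube_moment_fluxKernelGrad_le` — the theorem.

Consumer: cell `ad-ideate`, K1L_D `stmt-AnomalousDissipation-27980`, W3-E (i) (crux memo `Lines/onelevel-W3E-k3l-lyapunov.md`,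
re-plan P2d).

## Mathlib / tree search
Tree: the five imported brick files (this seat, p674891 … p678343); `Torus.integral_norm_sq_trigPoly` (Parseval),
`Torus.freqBall`/`mem_freqBall`/`not_mem_freqBall`, `Torus.measurable_reprc`, `abs_reprc_apply_le`.  Mathlib:
`ContDiff.sum/mul/pow`, `contDiff_apply`, `contDiff_infty`, `HasCompactSupport.intro`, `pi_norm_le_iff_of_nonneg`,
`Fintype.card_piFinset`, `Int.card_Icc`, `Nat.le_ceil`, `Nat.ceil_lt_add_one`, `Real.sqrt_mul'`, `Integrable.of_bound`.

## References
* L. Grafakos, *Classical Fourier Analysis*, 3rd ed., GTM 249, Springer 2014, §3.3.1 (decay of Fourier coefficients of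
  smooth functions; summation by parts), Prop. 3.2.7 (3) (Parseval). [`Grafakos2014`]
-/

noncomputable section

open MeasureTheory Set Filter Complex UnitAddTorus Function
open scoped ContDiff

namespace Literature.Analysis.FunctionSpaces

namespace Torus

variable {d : Type*} [Fintype d] [DecidableEq d]

/-! ## §1 Lattice differences of a sampled rescaled symbol -/

/-- **`‖D_j^p c(k)‖ ≤ ε^{p-1}·sup ‖D^p H‖` for `c(k) = ε⁻¹ H(εk)`**, `H ∈ C^p(ℝ^d)` with bounded `p`-th derivative.
[cite: Grafakos2014, §3.3.1] -/
theorem norm_iterate_latticeDiff_scaledSymbol_le {H : (d → ℝ) → ℂ} {p : ℕ} (hH : ContDiff ℝ p H) {M : ℝ}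
    (hM : ∀ ξ, ‖iteratedFDeriv ℝ p H ξ‖ ≤ M) {ε : ℝ} (hε : 0 < ε) (c : (d → ℤ) → ℂ)
    (hc : ∀ k, c k = ε⁻¹ • H (ε • fun i => (k i : ℝ))) (j : d) (k : d → ℤ) :
    ‖((fun (c' : (d → ℤ) → ℂ) (k : d → ℤ) => c' (k - Pi.single j 1) - c' k)^[p] c) k‖ ≤ ε ^ p / ε * M := by
  set G : (d → ℝ) → ℂ := fun ξ => ε⁻¹ • H (ε • ξ) with hG
  refine Literature.Analysis.Fourier.LatticeDiff.norm_iterate_latticeDiff_le p G c (fun k => by rw [hc k])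
    j (ε ^ p / ε * M) (fun k' => ?_) k
  have hline : (fun t : ℝ => G (fun i => (k' i : ℝ) + t * (Pi.single j (1:ℝ) : d → ℝ) i)) =
      fun t : ℝ => ε⁻¹ • H (ε • ((fun i => (k' i : ℝ)) + t • (Pi.single j (1:ℝ) : d → ℝ))) := by
    funext t
    rfl
  rw [hline]
  refine ⟨?_, fun t => ?_⟩
  · exact (hH.comp ((contDiff_const.add (contDiff_id.smul contDiff_const)).const_smul ε)).const_smul ε⁻¹
  · have h := Literature.Analysis.Fourier.LatticeDiff.norm_iteratedDeriv_scaledSymbol_line_le hH hM hε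
      (fun i => (k' i : ℝ)) (Pi.single j (1:ℝ) : d → ℝ) t
    have he : ‖(Pi.single j (1:ℝ) : d → ℝ)‖ = 1 := by
      rw [Pi.norm_single, norm_one]
    rw [he, one_pow, mul_one] at h
    exact h

/-! ## §2 The frequency box -/

/-- `#[-R, R]^d = (2R+1)^d` on `ℤ^d` (file-local). [folklore] -/
private theorem card_piFinset_Icc (R : ℕ) :
    (Fintype.piFinset fun _ : d => Finset.Icc (-(R : ℤ)) R).card = (2 * R + 1) ^ Fintype.card d := by
  rw [Fintype.card_piFinset, Finset.prod_const, Finset.card_univ]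
  congr 1
  rw [Int.card_Icc, show (R : ℤ) + 1 - -(R : ℤ) = ((2 * R + 1 : ℕ) : ℤ) by push_cast; ring, Int.toNat_natCast]

/-- `freqBall N ⊆ [-(N+p), N+p]^d` (file-local). [folklore] -/
private theorem freqBall_subset_piFinset_Icc (N p : ℕ) :
    (freqBall (d := d) N) ⊆ Fintype.piFinset fun _ : d => Finset.Icc (-((N + p : ℕ) : ℤ)) (N + p : ℕ) := by
  intro k hk
  have hbox : ∀ l, k l ∈ Finset.Icc (-(N : ℤ)) N := by
    unfold freqBall at hk
    exact Fintype.mem_piFinset.1 (Finset.mem_filter.1 hk).1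
  rw [Fintype.mem_piFinset]
  intro l
  have hl := Finset.mem_Icc.1 (hbox l)
  rw [Finset.mem_Icc]
  push_cast
  omega

/-- `k + i·e_j ∈ [-(N+p), N+p]^d` for `k ∈ freqBall N`, `i ≤ p` (file-local). [folklore] -/
private theorem add_single_mem_piFinset_Icc_of_mem_freqBall {N p : ℕ} {k : d → ℤ} (hk : k ∈ freqBall (d := d) N) (j : d)
    {i : ℕ} (hi : i ≤ p) :
    k + (i : ℤ) • Pi.single j (1:ℤ) ∈ Fintype.piFinset fun _ : d => Finset.Icc (-((N + p : ℕ) : ℤ)) (N + p : ℕ) := by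
  have hbox : ∀ l, k l ∈ Finset.Icc (-(N : ℤ)) N := by
    unfold freqBall at hk
    exact Fintype.mem_piFinset.1 (Finset.mem_filter.1 hk).1
  rw [Fintype.mem_piFinset]
  intro l
  have hl := Finset.mem_Icc.1 (hbox l)
  have hip : (i : ℤ) ≤ p := by exact_mod_cast hi
  rw [Finset.mem_Icc, Pi.add_apply, Pi.smul_apply, Pi.single_apply, smul_eq_mul]
  split_ifs
  · push_cast; omega
  · push_cast; omega

/-! ## §3 The third moment of the flux kernel -/

/-- **The weight is carried by the ball**: `Ψ(ε²|k|²) = 0` for `k ∉ freqBall ⌈1/ε⌉` when `Ψ` vanishes on `[1, ∞)`.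
[cite: Grafakos2014, §3.3.1] -/
theorem dissipWeight_eq_zero_of_not_mem_freqBall {Ψ : ℝ → ℝ} (hΨ1 : ∀ x, 1 ≤ x → Ψ x = 0) {ε : ℝ} (hε : 0 < ε)
    {k : d → ℤ} (hk : k ∉ freqBall (d := d) ⌈ε⁻¹⌉₊) : Ψ (ε ^ 2 * freqNormSq k) = 0 := by
  rw [not_mem_freqBall] at hk
  apply hΨ1
  have hN : ε⁻¹ ≤ (⌈ε⁻¹⌉₊ : ℝ) := Nat.le_ceil _
  have h1 : (1:ℝ) ≤ ε ^ 2 * (⌈ε⁻¹⌉₊ : ℝ) ^ 2 := by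
    have e : (1:ℝ) = ε ^ 2 * (ε⁻¹) ^ 2 := by field_simp
    rw [e]
    exact mul_le_mul_of_nonneg_left (pow_le_pow_left₀ (inv_nonneg.2 hε.le) hN 2) (sq_nonneg _)
  nlinarith [hk, sq_nonneg ε]

omit [DecidableEq d] in
/-- **`|∂_a K_ω(z)| ≤ ‖Σ_{k∈F} e_k(z) c_a(k)‖`** with `c_a(k) = ω_k · 2πi k_a`: the flux kernel is the real part of a
trigonometric polynomial. [cite: Grafakos2014, §3.3.1] -/
theorem abs_fluxKernelGrad_le_norm_trigPoly (F : Finset (d → ℤ)) (wt : (d → ℤ) → ℝ) (a : d) (z : UnitAddTorus d) :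
    |fluxKernelGrad F wt a z| ≤ ‖trigPoly F (fun k => ((wt k : ℝ) : ℂ) * (2 * Real.pi * I * (k a : ℂ))) z‖ := by
  have hre : fluxKernelGrad F wt a z = (trigPoly F (fun k => ((wt k : ℝ) : ℂ) * (2 * Real.pi * I * (k a : ℂ))) z).re := by
    rw [fluxKernelGrad, trigPoly_apply, Complex.re_sum]
    refine Finset.sum_congr rfl fun k _ => ?_
    rw [smul_eq_mul, show mFourier k z * (((wt k : ℝ) : ℂ) * (2 * Real.pi * I * (k a : ℂ))) =
      ((wt k : ℝ) : ℂ) * (2 * Real.pi * I * (k a : ℂ) * mFourier k z) by ring, Complex.re_ofReal_mul]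
  rw [hre]
  exact Complex.abs_re_le_norm _

omit [DecidableEq d] in
/-- `‖reprc z‖ ≤ card d` (file-local). [folklore] -/
private theorem norm_reprc_le_card'' (z : UnitAddTorus d) : ‖reprc z‖ ≤ Fintype.card d := by
  rw [EuclideanSpace.norm_eq]
  have h1 : ∑ i, ‖reprc z i‖ ^ 2 ≤ ∑ _i : d, (1 : ℝ) := Finset.sum_le_sum fun i _ => by
    rw [Real.norm_eq_abs]
    have := abs_reprc_apply_le z i
    nlinarith [abs_nonneg (reprc z i)]
  rw [Finset.sum_const, Finset.card_univ, nsmul_eq_mul, mul_one] at h1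
  calc Real.sqrt (∑ i, ‖reprc z i‖ ^ 2) ≤ Real.sqrt (Fintype.card d) := Real.sqrt_le_sqrt h1
    _ ≤ Fintype.card d := by
        rcases Nat.eq_zero_or_pos (Fintype.card d) with h | h
        · simp [h]
        · have h1 : (1:ℝ) ≤ Fintype.card d := by exact_mod_cast h
          rw [Real.sqrt_le_left (by linarith)]
          nlinarith

omit [DecidableEq d] in
/-- Integrability of `‖reprc z‖^p · g z` for continuous `g` (file-local). [folklore] -/
private theorem integrable_norm_reprc_pow_mul' {g : UnitAddTorus d → ℝ} (hg : Continuous g) (p : ℕ) :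
    Integrable (fun z : UnitAddTorus d => ‖reprc z‖ ^ p * g z) volume := by
  obtain ⟨C, hC⟩ := (isCompact_univ.image hg).isBounded.exists_norm_le
  have hm : AEStronglyMeasurable (fun z : UnitAddTorus d => ‖reprc z‖ ^ p * g z) volume :=
    ((measurable_reprc.norm.pow_const _).mul hg.measurable).aestronglyMeasurable
  refine Integrable.of_bound hm ((Fintype.card d : ℝ) ^ p * C) (ae_of_all _ fun z => ?_)
  rw [norm_mul, norm_pow, norm_norm]
  exact mul_le_mul (pow_le_pow_left₀ (norm_nonneg _) (norm_reprc_le_card'' z) _) (hC _ ⟨z, Set.mem_univ _, rfl⟩)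
    (norm_nonneg _) (by positivity)

/-- **Third moment of the dissipation-scale flux kernel**: for `Ψ ∈ C^∞(ℝ)` with `Ψ = 0` on `[1, ∞)` there is
`C = C(d, Ψ) ≥ 0` such that for all `0 < ε ≤ 1`, with `ω_k = Ψ(ε²|k|²)` on `F = freqBall ⌈1/ε⌉`,
`∫_𝕋 ‖reprc z‖³ Σ_a |Σ_{k∈F} ω_k (2πi k_a e_k(z)).re| dz ≤ C ε²`. [cite: Grafakos2014, §3.3.1] -/
theorem exists_cube_moment_fluxKernelGrad_le (Ψ : ℝ → ℝ) (hΨ : ContDiff ℝ ∞ Ψ) (hΨ1 : ∀ x, 1 ≤ x → Ψ x = 0) :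
    ∃ C : ℝ, 0 ≤ C ∧ ∀ ε : ℝ, 0 < ε → ε ≤ 1 →
      ∫ z : UnitAddTorus d, ‖reprc z‖ ^ 3 *
          ∑ a, |fluxKernelGrad (freqBall (d := d) ⌈ε⁻¹⌉₊) (fun k => Ψ (ε ^ 2 * freqNormSq k)) a z| ≤ C * ε ^ 2 := by
  -- the symbols `H_a(η) = Ψ(|η|²)·2πi η_a`
  set H : d → (d → ℝ) → ℂ := fun a η => ((Ψ (∑ i, η i ^ 2) : ℝ) : ℂ) * (2 * Real.pi * I * ((η a : ℝ) : ℂ))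
    with hHdef
  have hsq : ContDiff ℝ ∞ (fun η : d → ℝ => ∑ i, η i ^ 2) :=
    ContDiff.sum fun i _ => (contDiff_apply ℝ ℝ i).pow 2
  have hHs : ∀ a, ContDiff ℝ ∞ (H a) := fun a =>
    (Complex.ofRealCLM.contDiff.comp (hΨ.comp hsq)).mul
      (contDiff_const.mul (Complex.ofRealCLM.contDiff.comp (contDiff_apply ℝ ℝ a)))
  have hHn : ∀ a (n : ℕ), ContDiff ℝ n (H a) := fun a n => contDiff_infty.1 (hHs a) n
  have hHc : ∀ a, HasCompactSupport (H a) := by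
    intro a
    refine HasCompactSupport.intro (isCompact_closedBall (0 : d → ℝ) 1) fun η hη => ?_
    have h1 : 1 ≤ ∑ i, η i ^ 2 := by
      refine (le_or_gt 1 (∑ i, η i ^ 2)).resolve_right fun hlt => hη ?_
      rw [Metric.mem_closedBall, dist_zero_right, pi_norm_le_iff_of_nonneg zero_le_one]
      intro i
      rw [Real.norm_eq_abs]
      have : η i ^ 2 ≤ ∑ l, η l ^ 2 := Finset.single_le_sum (fun l _ => sq_nonneg (η l)) (Finset.mem_univ i)
      exact (sq_le_one_iff_abs_le_one _).1 (by linarith)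
    show ((Ψ (∑ i, η i ^ 2) : ℝ) : ℂ) * (2 * Real.pi * I * ((η a : ℝ) : ℂ)) = 0
    rw [hΨ1 _ h1, Complex.ofReal_zero, zero_mul]
  -- sup norms of the derivatives
  have hMex : ∀ a (i : ℕ), ∃ M : ℝ, 0 ≤ M ∧ ∀ ξ, ‖iteratedFDeriv ℝ i (H a) ξ‖ ≤ M := fun a i =>
    Literature.Analysis.Fourier.LatticeDiff.exists_bound_iteratedFDeriv_of_hasCompactSupport (hHn a i) (hHc a)
  choose M hM0 hM using hMex
  -- the Sobolev order, the Euclidean constant, the box constant, the symbol constant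
  set s : ℕ := Fintype.card d / 2 + 4 with hsdef
  have hs : (Fintype.card d : ℝ) + 6 < 2 * s := by
    have : Fintype.card d + 6 < 2 * s := by omega
    exact_mod_cast this
  set I₀ : ℝ := ∫ u : EuclideanSpace ℝ d, ‖u‖ ^ 6 / (1 + ‖u‖ ^ 2) ^ s with hI₀def
  have hI₀ : 0 ≤ I₀ := integral_nonneg fun u => by positivity
  set Cbox : ℝ := (2 * s + 5 : ℝ) ^ Fintype.card d with hCboxdef
  set 𝓜 : d → ℝ := fun a => ∑ i ∈ Finset.range (s + 1), (s.choose i : ℝ) * (Fintype.card d : ℝ) ^ i * M a i ^ 2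
    with h𝓜def
  have h𝓜0 : ∀ a, 0 ≤ 𝓜 a := fun a => Finset.sum_nonneg fun i _ => by positivity
  refine ⟨∑ a, Real.sqrt (I₀ * (Cbox * 𝓜 a)), Finset.sum_nonneg fun a _ => Real.sqrt_nonneg _, fun ε hε hε1 => ?_⟩
  -- the ball, the box, the weight, the coefficients
  set N : ℕ := ⌈ε⁻¹⌉₊ with hNdef
  have hNle : (N : ℝ) ≤ ε⁻¹ + 1 := (Nat.ceil_lt_add_one (inv_nonneg.2 hε.le)).le
  set F : Finset (d → ℤ) := freqBall (d := d) N with hFdef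
  set B : Finset (d → ℤ) := Fintype.piFinset fun _ : d => Finset.Icc (-((N + s : ℕ) : ℤ)) (N + s : ℕ) with hBdef
  set wt : (d → ℤ) → ℝ := fun k => Ψ (ε ^ 2 * freqNormSq k) with hwtdef
  set c : d → (d → ℤ) → ℂ := fun a k => ((wt k : ℝ) : ℂ) * (2 * Real.pi * I * (k a : ℂ)) with hcdef
  have hcH : ∀ a k, c a k = ε⁻¹ • H a (ε • fun i => (k i : ℝ)) := by
    intro a k
    simp only [hcdef, hHdef, hwtdef, Pi.smul_apply, smul_eq_mul, freqNormSq, Complex.real_smul]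
    have hsum : ∑ i, (ε * (k i : ℝ)) ^ 2 = ε ^ 2 * ∑ i, ((k i : ℝ)) ^ 2 := by
      rw [Finset.mul_sum]
      exact Finset.sum_congr rfl fun i _ => by ring
    rw [hsum]
    set A : ℂ := ((Ψ (ε ^ 2 * ∑ i, ((k i : ℝ)) ^ 2) : ℝ) : ℂ)
    have hε' : (ε : ℂ) ≠ 0 := by exact_mod_cast hε.ne'
    push_cast
    field_simp
  have hwtF : ∀ k, k ∉ F → wt k = 0 := fun k hk => dissipWeight_eq_zero_of_not_mem_freqBall hΨ1 hε hk
  have hcF : ∀ a k, k ∉ F → c a k = 0 := fun a k hk => by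
    simp only [hcdef, hwtF k hk, Complex.ofReal_zero, zero_mul]
  have hFB : ∀ p : ℕ, p ≤ s → ∀ j : d, ∀ k ∈ F, ∀ i : ℕ, i ≤ p → k + (i : ℤ) • Pi.single j (1:ℤ) ∈ B :=
    fun p hp j k hk i hi => add_single_mem_piFinset_Icc_of_mem_freqBall hk j (hi.trans hp)
  have hFsubB : F ⊆ B := freqBall_subset_piFinset_Icc N s
  -- the box count
  have hcardB : (B.card : ℝ) ≤ Cbox / ε ^ Fintype.card d := by
    rw [hBdef, card_piFinset_Icc, le_div_iff₀ (pow_pos hε _), hCboxdef]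
    push_cast
    rw [← mul_pow]
    refine pow_le_pow_left₀ (by positivity) ?_ _
    have hNε : (N : ℝ) * ε ≤ 1 + ε := by
      calc (N : ℝ) * ε ≤ (ε⁻¹ + 1) * ε := mul_le_mul_of_nonneg_right hNle hε.le
        _ = 1 + ε := by field_simp
    nlinarith
  -- coefficient differences
  have hD : ∀ a (i : ℕ) (j : d) (k : d → ℤ),
      ‖((fun (c' : (d → ℤ) → ℂ) (k : d → ℤ) => c' (k - Pi.single j 1) - c' k)^[i] (c a)) k‖ ≤ ε ^ i / ε * M a i :=
    fun a i j k => norm_iterate_latticeDiff_scaledSymbol_le (hHn a i) (hM a i) hε (c a) (hcH a) j k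
  have hc0 : ∀ a k, ‖c a k‖ ≤ ε ^ 0 / ε * M a 0 := by
    intro a k
    rw [hcH a k, norm_smul, norm_inv, Real.norm_eq_abs, abs_of_pos hε, pow_zero, one_div]
    refine mul_le_mul_of_nonneg_left ?_ (inv_nonneg.2 hε.le)
    rw [← norm_iteratedFDeriv_zero (𝕜 := ℝ)]
    exact hM a 0 _
  -- the pieces `J_{a,i} = ∫ |z|^{2i} |K_a|²`
  have hJ : ∀ a, ∀ i ∈ Finset.range (s + 1),
      ∫ z : UnitAddTorus d, ‖reprc z‖ ^ (2 * i) * ‖trigPoly F (c a) z‖ ^ 2 ≤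
        (Fintype.card d : ℝ) ^ i * B.card * (ε ^ i / ε * M a i) ^ 2 := by
    intro a i hi
    have his : i ≤ s := Nat.lt_succ_iff.1 (Finset.mem_range.1 hi)
    rcases Nat.eq_zero_or_pos i with rfl | hipos
    · simp only [Nat.mul_zero, pow_zero, one_mul]
      rw [integral_norm_sq_trigPoly]
      calc ∑ k ∈ F, ‖c a k‖ ^ 2 ≤ ∑ _k ∈ F, (ε ^ 0 / ε * M a 0) ^ 2 :=
            Finset.sum_le_sum fun k _ => pow_le_pow_left₀ (norm_nonneg _) (hc0 a k) 2
        _ = F.card * (ε ^ 0 / ε * M a 0) ^ 2 := by rw [Finset.sum_const, nsmul_eq_mul]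
        _ ≤ B.card * (ε ^ 0 / ε * M a 0) ^ 2 := by
            have : (F.card : ℝ) ≤ B.card := by exact_mod_cast Finset.card_le_card hFsubB
            gcongr
    · calc ∫ z : UnitAddTorus d, ‖reprc z‖ ^ (2 * i) * ‖trigPoly F (c a) z‖ ^ 2
          ≤ (Fintype.card d : ℝ) ^ (i - 1) / 16 ^ i *
              ∑ j, ∑ k ∈ B, ‖((fun (c' : (d → ℤ) → ℂ) (k : d → ℤ) => c' (k - Pi.single j 1) - c' k)^[i] (c a)) k‖ ^ 2 :=
            integral_norm_reprc_pow_mul_norm_sq_trigPoly_le F B (c a) i hipos (hcF a) (hFB i his)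
        _ ≤ (Fintype.card d : ℝ) ^ (i - 1) / 16 ^ i * ∑ _j : d, ∑ _k ∈ B, (ε ^ i / ε * M a i) ^ 2 := by
            gcongr with j _ k _
            exact hD a i j k
        _ = (Fintype.card d : ℝ) ^ (i - 1) * Fintype.card d * B.card * (ε ^ i / ε * M a i) ^ 2 / 16 ^ i := by
            rw [Finset.sum_const, Finset.sum_const, Finset.card_univ, nsmul_eq_mul, nsmul_eq_mul]
            ring
        _ = (Fintype.card d : ℝ) ^ i * B.card * (ε ^ i / ε * M a i) ^ 2 / 16 ^ i := by
            rw [← pow_succ, show i - 1 + 1 = i by omega]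
        _ ≤ (Fintype.card d : ℝ) ^ i * B.card * (ε ^ i / ε * M a i) ^ 2 :=
            div_le_self (by positivity) (one_le_pow₀ (by norm_num))
  -- `J_a = ∫ (ε² + |z|²)^s |K_a|² ≤ Cbox · 𝓜 a · ε^{2s} / (ε^d ε²)`
  have hJsum : ∀ a, ∫ z : UnitAddTorus d, (ε ^ 2 + ‖reprc z‖ ^ 2) ^ s * ‖trigPoly F (c a) z‖ ^ 2 ≤
      Cbox / ε ^ Fintype.card d * (ε ^ (2 * s) / ε ^ 2) * 𝓜 a := by
    intro a
    rw [integral_weight_mul_norm_sq_eq_sum (continuous_trigPoly F (c a)) ε s]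
    calc ∑ i ∈ Finset.range (s + 1), (s.choose i : ℝ) * ε ^ (2 * (s - i)) *
            ∫ z : UnitAddTorus d, ‖reprc z‖ ^ (2 * i) * ‖trigPoly F (c a) z‖ ^ 2
        ≤ ∑ i ∈ Finset.range (s + 1), (s.choose i : ℝ) * ε ^ (2 * (s - i)) *
            ((Fintype.card d : ℝ) ^ i * B.card * (ε ^ i / ε * M a i) ^ 2) := by
          gcongr with i hi
          exact hJ a i hi
      _ = B.card * (ε ^ (2 * s) / ε ^ 2) * 𝓜 a := by
          rw [h𝓜def, Finset.mul_sum]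
          refine Finset.sum_congr rfl fun i hi => ?_
          have his : i ≤ s := Nat.lt_succ_iff.1 (Finset.mem_range.1 hi)
          have hpow : ε ^ (2 * (s - i)) * (ε ^ i / ε) ^ 2 = ε ^ (2 * s) / ε ^ 2 := by
            rw [div_pow, ← pow_mul, show 2 * s = 2 * (s - i) + i * 2 by omega, pow_add]
            ring
          calc (s.choose i : ℝ) * ε ^ (2 * (s - i)) * ((Fintype.card d : ℝ) ^ i * B.card * (ε ^ i / ε * M a i) ^ 2)
              = (s.choose i : ℝ) * (Fintype.card d : ℝ) ^ i * B.card * M a i ^ 2 *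
                  (ε ^ (2 * (s - i)) * (ε ^ i / ε) ^ 2) := by ring
            _ = B.card * (ε ^ (2 * s) / ε ^ 2) * ((s.choose i : ℝ) * (Fintype.card d : ℝ) ^ i * M a i ^ 2) := by
                rw [hpow]; ring
      _ ≤ Cbox / ε ^ Fintype.card d * (ε ^ (2 * s) / ε ^ 2) * 𝓜 a :=
          mul_le_mul_of_nonneg_right (mul_le_mul_of_nonneg_right hcardB (by positivity)) (h𝓜0 a)
  -- the weight integral
  have hIw : ∫ z : UnitAddTorus d, ‖reprc z‖ ^ 6 / (ε ^ 2 + ‖reprc z‖ ^ 2) ^ s ≤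
      (ε ^ 6 * ε ^ Fintype.card d / ε ^ (2 * s)) * I₀ := integral_norm_reprc_six_div_weight_le hε s hs
  have hIw0 : 0 ≤ ∫ z : UnitAddTorus d, ‖reprc z‖ ^ 6 / (ε ^ 2 + ‖reprc z‖ ^ 2) ^ s :=
    integral_nonneg fun z => by positivity
  -- per component
  have hkey : ∀ a, ∫ z : UnitAddTorus d, ‖reprc z‖ ^ 3 * ‖trigPoly F (c a) z‖ ≤
      Real.sqrt (I₀ * (Cbox * 𝓜 a)) * ε ^ 2 := by
    intro a
    have hJ0 : 0 ≤ ∫ z : UnitAddTorus d, (ε ^ 2 + ‖reprc z‖ ^ 2) ^ s * ‖trigPoly F (c a) z‖ ^ 2 :=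
      integral_nonneg fun z => by positivity
    refine (integral_cube_moment_le_sqrt_mul_sqrt (continuous_trigPoly F (c a)) hε s).trans ?_
    rw [← Real.sqrt_mul' _ hJ0, show Real.sqrt (I₀ * (Cbox * 𝓜 a)) * ε ^ 2 =
      Real.sqrt (I₀ * (Cbox * 𝓜 a) * (ε ^ 2) ^ 2) by
        rw [Real.sqrt_mul' _ (sq_nonneg _), Real.sqrt_sq (sq_nonneg _)]]
    refine Real.sqrt_le_sqrt ?_
    calc (∫ z : UnitAddTorus d, ‖reprc z‖ ^ 6 / (ε ^ 2 + ‖reprc z‖ ^ 2) ^ s) *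
          ∫ z : UnitAddTorus d, (ε ^ 2 + ‖reprc z‖ ^ 2) ^ s * ‖trigPoly F (c a) z‖ ^ 2
        ≤ ((ε ^ 6 * ε ^ Fintype.card d / ε ^ (2 * s)) * I₀) *
            (Cbox / ε ^ Fintype.card d * (ε ^ (2 * s) / ε ^ 2) * 𝓜 a) :=
          mul_le_mul hIw (hJsum a) hJ0 (by positivity)
      _ = I₀ * (Cbox * 𝓜 a) * (ε ^ 2) ^ 2 := by
          field_simp
  -- pointwise domination and integrability
  have hptw : ∀ a z, |fluxKernelGrad F wt a z| ≤ ‖trigPoly F (c a) z‖ := fun a z =>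
    abs_fluxKernelGrad_le_norm_trigPoly F wt a z
  have hint1 : ∀ a, Integrable (fun z : UnitAddTorus d => ‖reprc z‖ ^ 3 * |fluxKernelGrad F wt a z|) volume :=
    fun a => integrable_norm_reprc_pow_mul' ((continuous_fluxKernelGrad F wt a).abs) 3
  have hint2 : ∀ a, Integrable (fun z : UnitAddTorus d => ‖reprc z‖ ^ 3 * ‖trigPoly F (c a) z‖) volume :=
    fun a => integrable_norm_reprc_pow_mul' ((continuous_trigPoly F (c a)).norm) 3
  calc ∫ z : UnitAddTorus d, ‖reprc z‖ ^ 3 * ∑ a, |fluxKernelGrad F wt a z|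
      = ∫ z : UnitAddTorus d, ∑ a, ‖reprc z‖ ^ 3 * |fluxKernelGrad F wt a z| :=
        integral_congr_ae (ae_of_all _ fun z => by simp only [Finset.mul_sum])
    _ = ∑ a, ∫ z : UnitAddTorus d, ‖reprc z‖ ^ 3 * |fluxKernelGrad F wt a z| :=
        integral_finsetSum _ fun a _ => hint1 a
    _ ≤ ∑ a, ∫ z : UnitAddTorus d, ‖reprc z‖ ^ 3 * ‖trigPoly F (c a) z‖ :=
        Finset.sum_le_sum fun a _ => integral_mono (hint1 a) (hint2 a) fun z =>
          mul_le_mul_of_nonneg_left (hptw a z) (pow_nonneg (norm_nonneg _) _)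
    _ ≤ ∑ a, Real.sqrt (I₀ * (Cbox * 𝓜 a)) * ε ^ 2 := Finset.sum_le_sum fun a _ => hkey a
    _ = (∑ a, Real.sqrt (I₀ * (Cbox * 𝓜 a))) * ε ^ 2 := by rw [Finset.sum_mul]

end Torus

end Literature.Analysis.FunctionSpaces

end
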